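import Summits.CriticalPhenomena.CardyFormulaZ2.Theorems.CardyBoundaryCoulombGasStripClusterRatesTwoClusterUpperWindow
import Summits.CriticalPhenomena.CardyFormulaZ2.Theorems.CardyBoundaryCoulombGasStripClusterRatesArmEvent
import Summits.CriticalPhenomena.CardyFormulaZ2.Theorems.CardyBoundaryCoulombGasStripClusterRatesArmReimer
import Summits.CriticalPhenomena.CardyFormulaZ2.Theorems.CardyBoundaryCoulombGasStripClusterRatesArmRate
import Summits.CriticalPhenomena.CardyFormulaZ2.Theorems.CardyBoundaryCoulombGasStripClusterRatesArmLimitKac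
import Summits.CriticalPhenomena.CardyFormulaZ2.Theorems.CardyBoundaryCoulombGasStripClusterRatesArmLimitWindow

/-!
# The BK–Reimer three-arm bound `p₂ ≤ p₁²·p₁*` and the sharpened two-cluster windows
# `3 log 2 ≤ lim n·γ₂(n) ≤ 144 log 2` (unconditional), `π ≤ lim n·γ₂(n) ≤ 3π` (under the conjunct)

Support file for line `two-cluster-rate-is-stationary-gap` (crux `StripClusterRates`,
stmt-CriticalPhenomena-13878), lead c5; companion of `…TwoClusterUpperWindow` (band construction, upper
edges). Here the LOWER edges are sharpened from BK (`p₂ ≤ p₁²`, factor 2) to BK–REIMER WITH THE DUAL ARM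
(factor 3): on lattice configurations the two-cluster event lies in `LR □ (LR □ TBᶜ)` (`…ArmEvent`: two
disjoint open LR crossings, and NO open top-bottom crossing of the rectangle since such a crossing would
meet and join them), Reimer's inequality bounds the probability by `p₁(m,n)²·(1 − P[TB]) = p₁(m,n)²·p₁(m+1,n−1)`
(`…ArmReimer`, duality for the last factor), and rates/limits follow (`…ArmRate`, `…ArmLimitKac`,
`…ArmLimitWindow`):

* §1 `arm_pTwo_le : p₂(m,n) ≤ p₁(m,n)²·p₁(m+1,n−1)` (`n ≥ 1`).
* §2 `arm_rateTwo_ge : 2γ₁(n) + γ₁(n−1) ≤ γ₂(n)` and `arm_rateTwo_ge_three_mul : 3γ₁(n) ≤ γ₂(n)` (`n ≥ 2`);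
  together with the band inequality `γ₂(3h+3) ≤ 3γ₁(h)` of the companion file the two rate functions of the
  crux are now tied by `3γ₁(n) ≤ γ₂(n)` and `γ₂(3h+3) ≤ 3γ₁(h)` (`stripClusterRates_three_arm_sandwich`).
* §3 UNCONDITIONAL WINDOW `nMul_rateTwo_limit_mem_window' : 3 log 2 ≤ L₂ ≤ 144 log 2` (`L₂ ∈ [2.079…, 99.8…]`).
* §4 CONDITIONAL WINDOW under the γ₁-half / the conjunct: `π ≤ L₂ ≤ 3π`
  (`nMul_rateTwo_limit_mem_window_of_kacOne'`, `twoCluster_window_of_cardyFormulaZ2'`, registered) — in Kac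
  units `h ∈ [1, 3]` for the two-cluster exponent, the crux claiming `h_{1,5} = 2`.

No definitions; `pOne`, `pTwo`, `rateSeqOne`, `rateSeqTwo` are the abbreviations of `Negative.KacFromAboveFalse`.

References: [ReimerCPC2000]; [GrimmettPercolation1999] §2.3, §11.2; [Aizenman1997] Thm 3; [Cardy1998] eq. (bb).
-/

noncomputable section

open MeasureTheory Filter Topology
open Literature.Probability.LatticeModels Literature.Probability.Percolation
open scoped Literature.Probability.Percolation

namespace Summit.CriticalPhenomena.CardyFormulaZ2.Cruxes.StripClusterRates.TwoClusterRateIsStationaryGap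

open Summit.CriticalPhenomena.CardyFormulaZ2.Theorems.StripClusterRates.Negative

/-! ## §1 The three-arm upper bound on `p₂` -/

/-- **BK–Reimer three-arm bound** (registered sub-goal `arm_pTwo_le`): for `n ≥ 1` and all `m`,
`p₂(m,n) ≤ p₁(m,n)² · p₁(m+1,n−1)` — the two-cluster event lies a.e. in `LR □ (LR □ TBᶜ)`
(`arm_threeArm_of_twoCluster`) and Reimer's inequality applies twice (`arm_real_threeArm_le`; the factor
`1 − P[TB of [0,m]×[0,n]] = p₁(m+1,n−1)` by duality). [cite: ReimerCPC2000, main theorem] -/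
theorem arm_pTwo_le : ∀ m n : ℕ, 1 ≤ n → (bondPercolation (zdGraph 2) half).real {ω | ∃ x₁ ∈ (leftSide m n : Set (Site 2)), ∃ y₁ ∈ (rightSide m n : Set (Site 2)), ∃ x₂ ∈ (leftSide m n : Set (Site 2)), ∃ y₂ ∈ (rightSide m n : Set (Site 2)), ω ∈ openConnIn (rectangle m n : Set (Site 2)) x₁ y₁ ∧ ω ∈ openConnIn (rectangle m n : Set (Site 2)) x₂ y₂ ∧ ω ∉ openConnIn (rectangle m n : Set (Site 2)) x₁ x₂} ≤ crossingProb half m n ^ 2 * crossingProb half (m + 1) (n - 1) := by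
  intro m n hn
  refine le_trans ?_ (arm_real_threeArm_le m n hn)
  refine ENNReal.toReal_mono (measure_ne_top _ _) (measure_mono_ae ?_)
  filter_upwards [ae_subset_edgeSet (zdGraph 2) half] with ω hω h
  exact arm_threeArm_of_twoCluster m n ω hω h

/-- `arm_pTwo_le` in the vocabulary of `Negative.KacFromAboveFalse`: `pTwo m n ≤ pOne m n ^ 2 * pOne (m+1) (n-1)`. [cite: ReimerCPC2000, main theorem] -/
theorem arm_pTwo_le' {n : ℕ} (hn : 1 ≤ n) (m : ℕ) : pTwo m n ≤ pOne m n ^ 2 * pOne (m + 1) (n - 1) :=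
  arm_pTwo_le m n hn

/-! ## §2 The structural rate inequality `2γ₁(n) + γ₁(n−1) ≤ γ₂(n)` -/

/-- **Three-arm lower bound on the two-cluster rate**: for `n ≥ 1` and any rates `γ₁(n)`, `γ'` of
`p₁(·,n)`, `p₁(·,n−1)` and `γ₂(n)` of `p₂(·,n)`: `2γ₁(n) + γ' ≤ γ₂(n)`. [folklore] -/
theorem arm_rateTwo_ge_of_rates {n : ℕ} (hn : 1 ≤ n) {γa γb γ₂ : ℝ} (ha : Tendsto (rateSeqOne n) atTop (𝓝 γa))
    (hb : Tendsto (rateSeqOne (n - 1)) atTop (𝓝 γb)) (h₂ : Tendsto (rateSeqTwo n) atTop (𝓝 γ₂)) :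
    2 * γa + γb ≤ γ₂ :=
  arm_rate_ge_of_le_prod n (fun m ↦ pTwo m n) γa γb γ₂
    (fun m ↦ lt_of_lt_of_le (by positivity) (pTwo_ge (m := m) hn)) (arm_pTwo_le' hn) ha hb h₂

/-- **Three-arm inequality between the two rate functions of the crux**: `2γ₁(n) + γ₁(n−1) ≤ γ₂(n)` for
every `n ≥ 2`. [folklore] -/
theorem arm_rateTwo_ge {γ₁ γ₂ : ℕ → ℝ}
    (h₁ : ∀ n : ℕ, 1 ≤ n → Tendsto (rateSeqOne n) atTop (𝓝 (γ₁ n)))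
    (h₂ : ∀ n : ℕ, 1 ≤ n → Tendsto (rateSeqTwo n) atTop (𝓝 (γ₂ n))) :
    ∀ n : ℕ, 2 ≤ n → 2 * γ₁ n + γ₁ (n - 1) ≤ γ₂ n :=
  fun n hn ↦ arm_rateTwo_ge_of_rates (by omega) (h₁ n (by omega)) (h₁ (n - 1) (by omega)) (h₂ n (by omega))

/-- **Factor three**: `3γ₁(n) ≤ γ₂(n)` for `n ≥ 2` (`γ₁` is antitone in the width, `rateOne_antitone`),
improving BK's `2γ₁(n) ≤ γ₂(n)`. [folklore] -/
theorem arm_rateTwo_ge_three_mul {γ₁ γ₂ : ℕ → ℝ}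
    (h₁ : ∀ n : ℕ, 1 ≤ n → Tendsto (rateSeqOne n) atTop (𝓝 (γ₁ n)))
    (h₂ : ∀ n : ℕ, 1 ≤ n → Tendsto (rateSeqTwo n) atTop (𝓝 (γ₂ n))) :
    ∀ n : ℕ, 2 ≤ n → 3 * γ₁ n ≤ γ₂ n := by
  intro n hn
  have h := arm_rateTwo_ge h₁ h₂ n hn
  have hanti := rateOne_antitone (Nat.sub_le n 1) (h₁ (n - 1) (by omega)) (h₁ n (by omega))
  linarith

/-! ## §3 The unconditional window, sharpened: `3 log 2 ≤ lim n·γ₂(n) ≤ 144 log 2` -/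

/-- **Lower edge `3 log 2`** (three-arm bound + self-duality `γ₁(k) ≥ log 2/(k+2)`). [folklore] -/
theorem nMul_rateTwo_limit_ge_three_log_two {γ₁ γ₂ : ℕ → ℝ}
    (h₁ : ∀ n : ℕ, 1 ≤ n → Tendsto (rateSeqOne n) atTop (𝓝 (γ₁ n)))
    (h₂ : ∀ n : ℕ, 1 ≤ n → Tendsto (rateSeqTwo n) atTop (𝓝 (γ₂ n))) {L₂ : ℝ}
    (hL : Tendsto (fun n : ℕ ↦ (n : ℝ) * γ₂ n) atTop (𝓝 L₂)) : 3 * Real.log 2 ≤ L₂ :=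
  arm_nMul_rateTwo_limit_ge_three_log_two γ₁ γ₂ h₁ (arm_rateTwo_ge h₁ h₂) L₂ hL

/-- **THE UNCONDITIONAL TWO-CLUSTER WINDOW, sharpened**: `3 log 2 ≤ lim n·γ₂(n) ≤ 144 log 2`, i.e.
`L₂ ∈ [2.079…, 99.8…]`, for every pair of rate functions of the crux and every limit; the crux claims `2π`. [cite: Aizenman1997, Thm 3] -/
theorem nMul_rateTwo_limit_mem_window' {γ₁ γ₂ : ℕ → ℝ}
    (h₁ : ∀ n : ℕ, 1 ≤ n → Tendsto (rateSeqOne n) atTop (𝓝 (γ₁ n)))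
    (h₂ : ∀ n : ℕ, 1 ≤ n → Tendsto (rateSeqTwo n) atTop (𝓝 (γ₂ n))) {L₂ : ℝ}
    (hL : Tendsto (fun n : ℕ ↦ (n : ℝ) * γ₂ n) atTop (𝓝 L₂)) :
    3 * Real.log 2 ≤ L₂ ∧ L₂ ≤ 144 * Real.log 2 :=
  ⟨nMul_rateTwo_limit_ge_three_log_two h₁ h₂ hL, nMul_rateTwo_limit_le h₁ h₂ hL⟩

/-! ## §4 The conditional window, sharpened: `π ≤ lim n·γ₂(n) ≤ 3π` under the γ₁-half -/

/-- **Lower edge `π` under the γ₁-half** (`n·(2γ₁(n) + γ₁(n−1)) → π`). [folklore] -/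
theorem nMul_rateTwo_limit_ge_pi_of_kacOne {γ₁ γ₂ : ℕ → ℝ}
    (h₁ : ∀ n : ℕ, 1 ≤ n → Tendsto (rateSeqOne n) atTop (𝓝 (γ₁ n)))
    (h₂ : ∀ n : ℕ, 1 ≤ n → Tendsto (rateSeqTwo n) atTop (𝓝 (γ₂ n)))
    (hK₁ : Tendsto (fun n : ℕ ↦ (n : ℝ) * γ₁ n) atTop (𝓝 (Real.pi / 3))) {L₂ : ℝ}
    (hL : Tendsto (fun n : ℕ ↦ (n : ℝ) * γ₂ n) atTop (𝓝 L₂)) : Real.pi ≤ L₂ :=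
  arm_nMul_rateTwo_limit_ge_pi γ₁ γ₂ (arm_rateTwo_ge h₁ h₂) hK₁ L₂ hL

/-- **THE CONDITIONAL WINDOW, sharpened**: under the γ₁-half, `π ≤ lim n·γ₂(n) ≤ 3π`
(`L₂ ∈ [3.14…, 9.42…]`; in Kac units `h ∈ [1, 3]`, the crux claims `h_{1,5} = 2`). [folklore] -/
theorem nMul_rateTwo_limit_mem_window_of_kacOne' {γ₁ γ₂ : ℕ → ℝ}
    (h₁ : ∀ n : ℕ, 1 ≤ n → Tendsto (rateSeqOne n) atTop (𝓝 (γ₁ n)))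
    (h₂ : ∀ n : ℕ, 1 ≤ n → Tendsto (rateSeqTwo n) atTop (𝓝 (γ₂ n)))
    (hK₁ : Tendsto (fun n : ℕ ↦ (n : ℝ) * γ₁ n) atTop (𝓝 (Real.pi / 3))) {L₂ : ℝ}
    (hL : Tendsto (fun n : ℕ ↦ (n : ℝ) * γ₂ n) atTop (𝓝 L₂)) : Real.pi ≤ L₂ ∧ L₂ ≤ 3 * Real.pi :=
  ⟨nMul_rateTwo_limit_ge_pi_of_kacOne h₁ h₂ hK₁ hL, nMul_rateTwo_limit_le_of_kacOne h₁ h₂ hK₁ hL⟩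

/-- **The conjunct localises the two-cluster constant to `[π, 3π]`** (registered sub-goal
`twoCluster_window_of_cardyFormulaZ2'`): under `CardyFormulaZ2`, every pair of rate functions of the crux
and every limit `L₂` of `n·γ₂(n)` obey `π ≤ L₂ ≤ 3π` (γ₁-half by `oneClusterKac_of_cardyFormulaZ2`, then
§4). [cite: Cardy1998, eq. (bb)] -/
theorem twoCluster_window_of_cardyFormulaZ2' : _root_.CardyFormulaZ2 → ∀ γ₁ γ₂ : ℕ → ℝ, (∀ n : ℕ, 1 ≤ n → Tendsto (fun m : ℕ ↦ -Real.log (crossingProb half m n) / (m : ℝ)) atTop (𝓝 (γ₁ n))) → (∀ n : ℕ, 1 ≤ n → Tendsto (fun m : ℕ ↦ -Real.log ((bondPercolation (zdGraph 2) half).real {ω | ∃ x₁ ∈ (leftSide m n : Set (Site 2)), ∃ y₁ ∈ (rightSide m n : Set (Site 2)), ∃ x₂ ∈ (leftSide m n : Set (Site 2)), ∃ y₂ ∈ (rightSide m n : Set (Site 2)), ω ∈ openConnIn (rectangle m n : Set (Site 2)) x₁ y₁ ∧ ω ∈ openConnIn (rectangle m n : Set (Site 2)) x₂ y₂ ∧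 ω ∉ openConnIn (rectangle m n : Set (Site 2)) x₁ x₂}) / (m : ℝ)) atTop (𝓝 (γ₂ n))) → ∀ L₂ : ℝ, Tendsto (fun n : ℕ ↦ (n : ℝ) * γ₂ n) atTop (𝓝 L₂) → Real.pi ≤ L₂ ∧ L₂ ≤ 3 * Real.pi :=
  fun h γ₁ _ h₁ h₂ _ hL =>
    nMul_rateTwo_limit_mem_window_of_kacOne' h₁ h₂ (oneClusterKac_of_cardyFormulaZ2 h γ₁ h₁) hL

/-- The crux's value inside the sharpened windows: `3 log 2 < 2π < 144 log 2` and `π < 2π < 3π`. [folklore] -/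
theorem two_pi_mem_windows' :
    (3 * Real.log 2 < 2 * Real.pi ∧ 2 * Real.pi < 144 * Real.log 2) ∧ (Real.pi < 2 * Real.pi ∧ 2 * Real.pi < 3 * Real.pi) := by
  have h1 := Real.log_two_lt_d9
  have h2 := Real.log_two_gt_d9
  have h3 := Real.pi_gt_three
  have h4 := Real.pi_lt_d2
  refine ⟨⟨by nlinarith, by nlinarith⟩, by nlinarith, by nlinarith⟩

/-! ## §5 Readback on the crux's own rates -/

/-- **The three-arm / band sandwich on the crux's rates**: `StripClusterRates` provides `γ₁, γ₂` with
`3γ₁(n) ≤ γ₂(n)` (`n ≥ 2`) and `γ₂(3h+3) ≤ 3γ₁(h)` (`h ≥ 1`), besides the two Kac limits. [cite: Cardy1998, eq. (bb)] -/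
theorem stripClusterRates_three_arm_sandwich
    (h : Summit.CriticalPhenomena.CardyFormulaZ2.Theses.CardyBoundaryCoulombGas.StripClusterRates) :
    ∃ γ₁ γ₂ : ℕ → ℝ,
      (∀ n : ℕ, 2 ≤ n → 3 * γ₁ n ≤ γ₂ n) ∧ (∀ h : ℕ, 1 ≤ h → γ₂ (3 * h + 3) ≤ 3 * γ₁ h) ∧
      Tendsto (fun n : ℕ ↦ (n : ℝ) * γ₁ n) atTop (𝓝 (Real.pi / 3)) ∧
      Tendsto (fun n : ℕ ↦ (n : ℝ) * γ₂ n) atTop (𝓝 (2 * Real.pi)) := by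
  obtain ⟨γ₁, γ₂, h1, h2, h3, h4⟩ := h
  exact ⟨γ₁, γ₂, arm_rateTwo_ge_three_mul h1 h2, band_rateTwo_le_three_mul h1 h2, h3, h4⟩

end Summit.CriticalPhenomena.CardyFormulaZ2.Cruxes.StripClusterRates.TwoClusterRateIsStationaryGap

end
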